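import Mathlib
import HarnessLib
import Literature.NumberTheory.Transcendental.KZDominatedFamilyRelations
import Summits.KontsevichZagierPeriods.KontsevichZagierPeriods.Theses.LinRedNormalForm
import Summits.KontsevichZagierPeriods.KontsevichZagierPeriods.Theorems.LinRedNormalFormDihedralNormalFormStubTorusDescentAux2

/-!
# `DihedralNormalForm`, line `torus-descent-sum-shadow`: toric dissect-and-fold tools (uncross, I)

Support file for the residual stub `stub_unnesting` of the crux `DihedralNormalForm`
(stmt-KontsevichZagierPeriods-3912, route `LinRedNormalForm`). Two dimension-free moves on
representations over the open cube `(0,1)ⁿ`, the two halves of the UNCROSS move of the engine: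

* `cubeDissectPair` (rule 1a): `[□ⁿ, f] ≡ [{x_p < x_{p'}}, f] + [{x_{p'} < x_p}, f]`, the wall
  `{x_p = x_{p'}}` being Lebesgue-null (`stub_torusDescentAux1`);
* `cubeFold` (rule 2, a monomial change of variables): the piece `{x ∈ □ᵏ⁺¹ | x_p < x_last}` is
  the image of the open cube under the fold `z ↦ (z with z_p replaced by z_p · z_last)` — the
  straightening map `str (Pi.single p 1)` of `…StubTorusDescentAux2` — with Jacobian `z_last`, so
  `[{x_p < x_last}, f] ≡ [□ᵏ⁺¹, z ↦ f(fold z) · z_last]`, absolute convergence being transported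
  by `MeasureTheory.integrableOn_image_iff_integrableOn_abs_det_fderiv_smul`.

References: M. Kontsevich, D. Zagier, *Periods* (2001), §1.2 (rules (1), (2)).
-/

noncomputable section

open MeasureTheory Set MvPolynomial
open Literature.ModelTheory.ExponentialFields (IsSemialgebraic)

namespace Summit.KontsevichZagierPeriods.DihedralNormalForm.TorusDescent

open Literature.NumberTheory.Transcendental
open Literature.ModelTheory.ExponentialFields

variable {k : ℕ}

/-! ### Rule (1a): the binary dissection `x_p ≶ x_{p'}` of the open cube -/

/-- The piece `{x ∈ (0,1)ⁿ | x_p < x_{p'}}` is `ℚ`-semialgebraic. [cite: BochnakCosteRoy1998, §2.1] -/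
theorem isSemialgebraic_ltPiece {n : ℕ} (p p' : Fin n) :
    IsSemialgebraic ℚ {x : Fin n → ℝ | (∀ i, x i ∈ Ioo (0:ℝ) 1) ∧ x p < x p'} := by
  have h : {x : Fin n → ℝ | (∀ i, x i ∈ Ioo (0:ℝ) 1) ∧ x p < x p'} =
      openUnitCube n ∩ {x : Fin n → ℝ | x p < x p'} := rfl
  rw [h]
  refine isSemialgebraic_openUnitCube.inter ?_
  simpa using isSemialgebraic_setOf_eval_lt (k := ℚ) (R := ℝ)
    (X p : MvPolynomial (Fin n) ℚ) (X p')

/-- Off the two pieces, a point of the open cube lies on the wall `{x_p = x_{p'}}`. [folklore] -/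
theorem cube_diff_pieces_subset {n : ℕ} (p p' : Fin n) :
    openUnitCube n \ ({x : Fin n → ℝ | (∀ i, x i ∈ Ioo (0:ℝ) 1) ∧ x p < x p'} ∪
        {x : Fin n → ℝ | (∀ i, x i ∈ Ioo (0:ℝ) 1) ∧ x p' < x p}) ⊆
      {x : Fin n → ℝ | x p = x p'} := by
  rintro x ⟨hx, hnot⟩
  simp only [mem_union, mem_setOf_eq, not_or, not_and, not_lt] at hnot
  exact le_antisymm (hnot.2 hx) (hnot.1 hx)

/-- **Rule (1a): dissecting a cube representation along `x_p ≶ x_{p'}`.** For `p ≠ p'`, a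
representation on the open cube `(0,1)ⁿ` is congruent modulo `KZ.relations` to the sum of its
restrictions to `{x_p < x_{p'}}` and `{x_{p'} < x_p}` (the wall is null).
[cite: KontsevichZagier2001, §1.2 rule (1)] -/
theorem cubeDissectPair : ∀ (n : ℕ) (p p' : Fin n), p ≠ p' → ∀ r : Literature.NumberTheory.Transcendental.KZ.IntegralRep n, r.domain = {x : Fin n → ℝ | ∀ i, x i ∈ Set.Ioo (0:ℝ) 1} → ∃ r₁ r₂ : Literature.NumberTheory.Transcendental.KZ.IntegralRep n, r₁.domain = {x : Fin n → ℝ | (∀ i, x i ∈ Set.Ioo (0:ℝ) 1) ∧ x p < x p'} ∧ r₁.integrand = r.integrand ∧ r₂.domain = {x : Fin n → ℝ | (∀ i, x i ∈ Set.Ioo (0:ℝ) 1) ∧ x p' < x p} ∧ r₂.integrand = r.integrand ∧ Literature.NumberTheory.Transcendental.KZ.of r - Literature.NumberTheory.Transcendental.KZ.of r₁ - Literature.NumberTheory.Transcendental.KZ.of r₂ ∈ Literature.NumberTheory.Transcendental.KZ.relations := by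
  intro n p p' hpp' r hdom
  have hdom' : r.domain = openUnitCube n := hdom
  set P₁ := {x : Fin n → ℝ | (∀ i, x i ∈ Set.Ioo (0:ℝ) 1) ∧ x p < x p'} with hP₁
  set P₂ := {x : Fin n → ℝ | (∀ i, x i ∈ Set.Ioo (0:ℝ) 1) ∧ x p' < x p} with hP₂
  have h1 : P₁ ⊆ r.domain := fun x hx => by rw [hdom']; exact hx.1
  have h2 : P₂ ⊆ r.domain := fun x hx => by rw [hdom']; exact hx.1
  have hU : IsSemialgebraic ℚ (P₁ ∪ P₂) :=
    (isSemialgebraic_ltPiece p p').union (isSemialgebraic_ltPiece p' p)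
  have hvol : volume (r.domain \ (P₁ ∪ P₂)) = 0 := by
    rw [hdom']
    exact measure_mono_null (cube_diff_pieces_subset p p') (stub_torusDescentAux1 n p p' hpp')
  let r₀ := r.restrict (P₁ ∪ P₂) hU (union_subset h1 h2)
  let r₁ := r.restrict P₁ (isSemialgebraic_ltPiece p p') h1
  let r₂ := r.restrict P₂ (isSemialgebraic_ltPiece p' p) h2
  have e0 : KZ.of r - KZ.of r₀ ∈ KZ.relations :=
    r.of_sub_of_restrict_mem_relations hU (union_subset h1 h2) hvol
  have hdisj : P₁ ∩ P₂ = ∅ :=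
    eq_empty_of_forall_notMem fun x hx => lt_asymm hx.1.2 hx.2.2
  have e1 : KZ.of r₀ - KZ.of r₁ - KZ.of r₂ ∈ KZ.domainAddRel :=
    ⟨n, r₀, r₁, r₂, rfl, by
      show volume (P₁ ∩ P₂) = 0
      rw [hdisj, measure_empty], fun _ _ => rfl, fun _ _ => rfl, rfl⟩
  refine ⟨r₁, r₂, rfl, rfl, rfl, rfl, ?_⟩
  have : KZ.of r - KZ.of r₁ - KZ.of r₂ =
      (KZ.of r - KZ.of r₀) + (KZ.of r₀ - KZ.of r₁ - KZ.of r₂) := by abel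
  rw [this]
  exact KZ.relations.add_mem e0 (KZ.domainAddRel_subset_relations e1)

/-! ### Rule (2): folding the piece `{x_p < x_last}` back onto the cube -/

/-- The exponent vector of the fold: `+1` at `p`, `0` elsewhere. [folklore] -/
theorem single_mem_signs (p : Fin k) :
    ∀ j : Fin k, (Pi.single p 1 : Fin k → ℤ) j = 0 ∨ (Pi.single p 1 : Fin k → ℤ) j = 1 ∨
      (Pi.single p 1 : Fin k → ℤ) j = -1 := by
  intro j
  by_cases h : j = p
  · subst h; simp
  · simp [Pi.single_eq_of_ne h]

/-- The wedge of the fold exponent is the whole open cube. [folklore] -/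
theorem wedge_single (p : Fin k) :
    wedge (Pi.single p 1 : Fin k → ℤ) = openUnitCube (k + 1) := by
  ext z
  simp only [wedge, openUnitCube, mem_setOf_eq, and_iff_left_iff_imp]
  intro _ j hj
  by_cases h : j = p
  · subst h; simp at hj
  · simp [Pi.single_eq_of_ne h] at hj

/-- The wedge of the opposite exponent is the piece `{x_p < x_last}`. [folklore] -/
theorem wedge_neg_single (p : Fin k) :
    wedge (-(Pi.single p 1 : Fin k → ℤ)) =
      {x : Fin (k + 1) → ℝ | (∀ i, x i ∈ Ioo (0:ℝ) 1) ∧ x (Fin.castSucc p) < x (Fin.last k)} := by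
  ext z
  simp only [wedge, mem_setOf_eq, Pi.neg_apply, neg_eq_iff_eq_neg, neg_neg]
  refine and_congr_right fun _ => ⟨fun h => h p (by simp), fun h j hj => ?_⟩
  by_cases hjp : j = p
  · subst hjp; exact h
  · simp [Pi.single_eq_of_ne hjp] at hj

/-- The fold `str (Pi.single p 1)` replaces `z_p` by `z_p · z_last` and fixes the other
coordinates. [folklore] -/
theorem str_single_eq_update (p : Fin k) (z : Fin (k + 1) → ℝ) :
    str (Pi.single p 1 : Fin k → ℤ) z =
      Function.update z (Fin.castSucc p) (z (Fin.castSucc p) * z (Fin.last k)) := by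
  ext i
  refine Fin.lastCases ?_ (fun j => ?_) i
  · rw [str_last, Function.update_of_ne (Fin.castSucc_lt_last p).ne']
  · rw [str_castSucc]
    by_cases h : j = p
    · subst h; simp
    · rw [Pi.single_eq_of_ne h, zpow_zero, mul_one,
        Function.update_of_ne (fun h' => h (Fin.castSucc_injective _ h'))]

/-- The Jacobian of the fold is `z_last`. [folklore] -/
theorem abs_det_strDeriv_single (p : Fin k) {z : Fin (k + 1) → ℝ} (hz : 0 < z (Fin.last k)) :
    |(strDeriv (Pi.single p 1 : Fin k → ℤ) z).det| = z (Fin.last k) := by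
  rw [abs_det_strDeriv _ hz, Finset.sum_pi_single']
  simp

/-- **Rule (2): folding the piece `{x_p < x_last}` onto the cube.** A representation `[P, f]` on
`P = {x ∈ (0,1)ᵏ⁺¹ | x_p < x_last}` is congruent modulo `KZ.relations` to the cube
representation `[□ᵏ⁺¹, z ↦ f(z with z_p ↦ z_p z_last) · z_last]` (the fold is the monomial
straightening map `str (Pi.single p 1)`, a bijection of the open cube onto `P` with Jacobian
`z_last`; absolute convergence is transported along it).
[cite: KontsevichZagier2001, §1.2 rule (2)] -/
theorem cubeFold : ∀ (k : ℕ) (p : Fin k) (r : Literature.NumberTheory.Transcendental.KZ.IntegralRep (k + 1)), r.domain = {x : Fin (k + 1) → ℝ | (∀ i, x i ∈ Set.Ioo (0:ℝ) 1) ∧ x (Fin.castSucc p) < x (Fin.last k)} → ∃ r' : Literature.NumberTheory.Transcendental.KZ.IntegralRep (k + 1), r'.domain = {x : Fin (k + 1) → ℝ | ∀ i, x i ∈ Set.Ioo (0:ℝ) 1} ∧ (∀ z : Fin (k + 1) → ℝ, r'.integrand z = r.integrand (Function.update z (Fin.castSucc p) (z (Fin.castSucc p) * z (Fin.last k))) *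 z (Fin.last k)) ∧ Literature.NumberTheory.Transcendental.KZ.of r - Literature.NumberTheory.Transcendental.KZ.of r' ∈ Literature.NumberTheory.Transcendental.KZ.relations := by
  intro k p r hdom
  set μ : Fin k → ℤ := Pi.single p 1 with hμ
  have hμs := single_mem_signs p
  have hdomW : r.domain = wedge (-μ) := by rw [hdom, wedge_neg_single]
  have himg : r.domain = str μ '' wedge μ := by rw [hdomW, image_str hμs]
  -- the folded integrand
  let g : (Fin (k + 1) → ℝ) → ℝ := fun z => r.integrand (str μ z) * z (Fin.last k)
  have hg : ∀ z, g z = r.integrand (Function.update z (Fin.castSucc p)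
      (z (Fin.castSucc p) * z (Fin.last k))) * z (Fin.last k) := fun z => by
    show r.integrand (str μ z) * z (Fin.last k) = _
    rw [str_single_eq_update]
  have hWsa : IsSemialgebraic ℚ (wedge μ) := isSemialgebraic_wedge μ
  have hg_sa : IsSemialgebraicFunOn ℚ (wedge μ) g := by
    refine IsSemialgebraicFunOn.fun_mul ?_ (isSemialgebraicFunOn_apply hWsa (Fin.last k))
    have hmaps : MapsTo (str μ) (wedge μ) r.domain := by
      rw [hdomW]; exact mapsTo_str hμs
    exact IsSemialgebraicFunOn.comp_isSemialgebraicMapOn_holds r.isSemialgebraicFunOn_integrand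
      (isSemialgebraicMapOn_str μ hWsa) hmaps
  have hg_int : IntegrableOn g (wedge μ) := by
    have h1 : IntegrableOn r.integrand (str μ '' wedge μ) := himg ▸ r.integrableOn
    have h2 := (integrableOn_image_iff_integrableOn_abs_det_fderiv_smul volume
      (measurableSet_wedge μ)
      (fun z hz => (hasFDerivAt_str μ (last_pos_of_mem_wedge hz).ne').hasFDerivWithinAt)
      (injOn_str μ) r.integrand).mp h1
    refine h2.congr_fun (fun z hz => ?_) (measurableSet_wedge μ)
    dsimp only [g]
    rw [smul_eq_mul, mul_comm, abs_det_strDeriv_single p (last_pos_of_mem_wedge hz)]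
  let r' : KZ.IntegralRep (k + 1) := ⟨wedge μ, g, hWsa, hg_sa, hg_int⟩
  have hcov : KZ.of r' - KZ.of r ∈ KZ.changeOfVariablesRel :=
    ⟨k + 1, r', r, str μ, strDeriv μ, isSemialgebraicMapOn_str μ hWsa,
      fun _ hz => (hasFDerivAt_str μ (last_pos_of_mem_wedge hz).ne').hasFDerivWithinAt,
      injOn_str μ, himg, fun z hz => by
        show g z = r.integrand (str μ z) * _
        rw [abs_det_strDeriv_single p (last_pos_of_mem_wedge hz)], rfl⟩
  refine ⟨r', ?_, hg, ?_⟩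
  · show wedge μ = _
    rw [hμ, wedge_single]; rfl
  · rw [← neg_sub]
    exact KZ.relations.neg_mem (KZ.changeOfVariablesRel_subset_relations hcov)

end Summit.KontsevichZagierPeriods.DihedralNormalForm.TorusDescent
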